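import Literature.AnabelianGeometry.AbsoluteAnabelian.AbsTopIThm26iiGaloisProofs
import Literature.AnabelianGeometry.AbsoluteAnabelian.AbsTopIRankFormulaProofs
import HarnessLib

/-!
# [AbsTopI] Thm 2.6 (iv): almost pro-omissive normal subgroups of `Π` lie in `Δ` — the printed
# proof, for all abstract extensions with MLF base, given the elasticity of `G_k`

S. Mochizuki, *Topics in Absolute Anabelian Geometry I: Generalities* (2012) [AbsTopI], Thm 2.6
(iv) p. 22 (manuscript pagination, lit key paper:url-11ac98ba15fc): "Let `k` be [an MLF].  Then
every almost pro-omissive topologically finitely generated closed normal subgroup of `Π` is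
contained in `Δ`.  If, moreover, `Σ ≠ Primes`, then the kernel of the quotient `Π ↠ G` may be
characterized ["group-theoretically"] as the maximal almost pro-omissive topologically finitely
generated closed normal subgroup of `Π`."  PRINTED PROOF (p. 24 l. 2–4): "Assertion (iv) follows
immediately from the existence of a surjection `G ↠ Ẑ` [cf., e.g., Proposition 1.5, (ii)],
together with the elasticity of `G` [cf. Theorem 1.7, (ii)], and the topological finite generation
of `Δ` [cf. Proposition 2.2]."

abc-iut-L4-t4 typed the item as the predicate `FundamentalExtension.Thm26iv S`
(`AbsTopISemiAbsolute.lean`).  This PROOF-ONLY companion (DAG node AbsTopI:Thm2.6(iv)) carries out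
the printed proof for EVERY abstract extension `1 → Δ → Π → G → 1` with MLF base data
`G ≅ G_k` (`E.MLFBase`):

* `not_isAlmostProOmissive_of_isOpen_absoluteGaloisGroup` — UNCONDITIONAL, the "surjection
  `G ↠ Ẑ`" input in the form the proof uses it: NO open subgroup of `G_k` is almost
  pro-omissive (an open `U ⊆ G_k` is `G_{k′}`, `GaloisSubextensionProofs`, so `δ¹_q(U) ≥ 1` for
  EVERY prime `q` by the LANDED rank formula `thm26_ii_delta_gal_holds`, whence `U ↠ ℤ_q` and an
  open normal subgroup of index `q`); transport lemmas for Def 1.1 (iii) along continuous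
  surjections (`IsProSet.of_surjective`, `IsAlmostProOmissive.of_surjective`);
* `FundamentalExtension.le_geom_of_isAlmostProOmissive_of_isElastic_gal` — the FIRST CLAUSE of
  Thm 2.6 (iv) GIVEN the elasticity of `G` ([AbsTopI] Thm 1.7 (ii), stated with the tree's
  `IsElastic` vocabulary as an explicit hypothesis; not a plan/FACT-LIST.md fact — GAP-LEDGER
  row G-w5d206-1): the image `M ⊆ G` of such an `N` is topologically finitely generated, closed,
  normal, almost pro-omissive, so by elasticity `M = 1` (whence `N ⊆ Ker(Π ↠ G) = Δ`) or `M` is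
  of finite index, hence open — excluded by the first bullet;
* `FundamentalExtension.thm26iv_of_isElastic_gal` — the whole typed predicate `E.Thm26iv Σ`
  GIVEN elasticity of `G`, Prop 2.2 BY NAME (`E.GeomTFG`) and the construction datum "`Δ` is
  pro-`Σ`, `Σ ⊆ Primes`" (`Σ ≠ Primes` leaves a prime `q ∉ Σ`, and `Δ` is then pro-`(≠ q)`);
* `FundamentalExtension.preservesGeom_of_thm26iv` (+ MLF corollary) — the characterization in
  use: under (iv) with `Σ ≠ Primes` on both sides, every `φ : Π_E ⥲ Π_F` carries `Δ_E` onto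
  `Δ_F` ([AbsAnab] Lemma 1.3.8 / [AbsTopII] Rmk 3.3.2 shape `PreservesGeom φ`).

HONEST FRAMING: classical profinite group theory over the tree's local class field theory; the
one named input, [AbsTopI] Thm 1.7 (ii) (elasticity of `G_k`), is carried as a hypothesis.
Nothing here bears on [IUTchIII] Cor. 3.12; typed ≠ proved for the conditional clauses.
-/

noncomputable section

open Topology Field

namespace Literature.AnabelianGeometry.AbsoluteAnabelian

universe u v

/-! ### Transport of [AbsTopI] Def 1.1 (iii) along continuous surjections -/

section Transport

variable {G : Type u} [Group G] [TopologicalSpace G] {H : Type v} [Group H] [TopologicalSpace H]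

/-- Pro-`Σ` is monotone in `Σ`. [cite: MochizukiAbsTopI2012, Def 1.1 (iii) p.10] -/
theorem IsProSet.mono {S T : Set ℕ} (h : IsProSet G S) (hST : S ⊆ T) : IsProSet G T :=
  ⟨fun U hU hUo q hq hdvd => hST (h.prime_dvd_index U hU hUo q hq hdvd)⟩

/-- Pro-`Σ` passes to the target of a continuous surjective homomorphism (an open normal subgroup
of the target pulls back to an open normal subgroup of the same index).
[cite: MochizukiAbsTopI2012, Def 1.1 (iii) p.10] -/
theorem IsProSet.of_surjective {S : Set ℕ} (f : G →ₜ* H) (hf : Function.Surjective f)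
    (h : IsProSet G S) : IsProSet H S := by
  refine ⟨fun V hV hVo q hq hdvd => h.prime_dvd_index _ (Subgroup.Normal.comap hV f.toMonoidHom)
    (hVo.preimage (map_continuous f)) q hq ?_⟩
  rwa [Subgroup.index_comap_of_surjective V hf]

/-- `ℤ_q → ℤ/q` is continuous (discrete target; its kernel `qℤ_q` is the open unit ball).
[folklore] -/
private theorem continuous_toZMod'' (q : ℕ) [Fact q.Prime] :
    Continuous (PadicInt.toZMod : ℤ_[q] → ZMod q) := by
  refine continuous_of_continuousAt_zero PadicInt.toZMod ?_
  rw [ContinuousAt, map_zero, nhds_discrete (ZMod q), Filter.tendsto_pure]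
  filter_upwards [Metric.ball_mem_nhds (0 : ℤ_[q]) one_pos] with x hx
  rw [Metric.mem_ball, dist_zero_right, PadicInt.norm_lt_one_iff_dvd,
    ← Ideal.mem_span_singleton, ← PadicInt.maximalIdeal_eq_span_p, ← PadicInt.ker_toZMod,
    RingHom.mem_ker] at hx
  exact hx

/-- A topological group with a continuous surjection onto `ℤ_q` has an open normal subgroup of
index `q` (the kernel of `G ↠ ℤ_q ↠ ℤ/q`). [folklore] -/
private theorem exists_isOpen_normal_index_eq_of_surjective_padicInt (q : ℕ) [Fact q.Prime]
    (f : G →ₜ* Multiplicative ℤ_[q]) (hf : Function.Surjective f) :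
    ∃ U : Subgroup G, U.Normal ∧ IsOpen (U : Set G) ∧ U.index = q := by
  let red : Multiplicative ℤ_[q] →* Multiplicative (ZMod q) :=
    (PadicInt.toZMod : ℤ_[q] →+* ZMod q).toAddMonoidHom.toMultiplicative
  have hred : Continuous red :=
    continuous_ofAdd.comp ((continuous_toZMod'' q).comp continuous_toAdd)
  have hreds : Function.Surjective red := fun y => by
    obtain ⟨x, hx⟩ :=
      ZMod.ringHom_surjective (PadicInt.toZMod (p := q)) (Multiplicative.toAdd y)
    exact ⟨Multiplicative.ofAdd x, by
      change Multiplicative.ofAdd (PadicInt.toZMod x) = y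
      rw [hx]
      rfl⟩
  let g : G →* Multiplicative (ZMod q) := red.comp f.toMonoidHom
  have hg : Continuous g := hred.comp (map_continuous f)
  have hgs : Function.Surjective g := hreds.comp hf
  refine ⟨g.ker, inferInstance, ?_, ?_⟩
  · exact (isOpen_discrete {(1 : Multiplicative (ZMod q))}).preimage hg
  · rw [Subgroup.index_ker, MonoidHom.range_eq_top.mpr hgs, Subgroup.card_top,
      Nat.card_congr Multiplicative.toAdd, Nat.card_zmod]

/-- A group with `δ¹_q ≥ 1` (hence surjecting continuously onto `ℤ_q`) is not pro-`Σ` for any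
`Σ ∌ q`. [cite: MochizukiAbsTopI2012, Def 1.1 (iii) p.10] -/
theorem not_isProSet_of_one_le_freeProlRank (q : ℕ) [Fact q.Prime]
    (h1 : 1 ≤ freeProlRank G q) {S : Set ℕ} (hq : q ∉ S) : ¬ IsProSet G S := by
  intro h
  obtain ⟨f, hf⟩ := exists_surjective_padicInt_of_one_le_freeProlRank q h1
  obtain ⟨U, hU, hUo, hidx⟩ := exists_isOpen_normal_index_eq_of_surjective_padicInt q f hf
  exact hq (h.prime_dvd_index U hU hUo q Fact.out (hidx ▸ dvd_rfl))

variable [IsTopologicalGroup G] [IsTopologicalGroup H]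

/-- The image of an OPEN subgroup under a continuous surjective homomorphism from a compact group
onto a Hausdorff group is open (compact, hence closed, and of finite index). [folklore] -/
private theorem isOpen_map_of_isOpen_of_surjective [CompactSpace G] [T2Space H] (f : G →ₜ* H)
    (hf : Function.Surjective f) (U : Subgroup G) (hU : IsOpen (U : Set G)) :
    IsOpen ((U.map f.toMonoidHom : Subgroup H) : Set H) := by
  have hc : IsClosed ((U.map f.toMonoidHom : Subgroup H) : Set H) := by
    rw [Subgroup.coe_map]
    exact ((U.isClosed_of_isOpen hU).isCompact.image (map_continuous f)).isClosed
  haveI : Finite (G ⧸ U) := Subgroup.quotient_finite_of_isOpen U hU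
  have hfin : U.FiniteIndex := Subgroup.finiteIndex_of_finite_quotient
  haveI : (U.map f.toMonoidHom).FiniteIndex :=
    ⟨fun h0 => hfin.index_ne_zero (Nat.eq_zero_of_zero_dvd (h0 ▸ U.index_map_dvd hf))⟩
  exact Subgroup.isOpen_of_isClosed_of_finiteIndex _ hc

/-- Almost pro-omissivity passes to the target of a continuous surjective homomorphism from a
compact group onto a Hausdorff group: the image of a pro-`(≠ p)` open subgroup is a pro-`(≠ p)`
open subgroup. [cite: MochizukiAbsTopI2012, Def 1.1 (iii) p.10] -/
theorem IsAlmostProOmissive.of_surjective [CompactSpace G] [T2Space H] (f : G →ₜ* H)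
    (hf : Function.Surjective f) (h : IsAlmostProOmissive G) : IsAlmostProOmissive H := by
  obtain ⟨p, U, hp, hUo, hU⟩ := h.exists_open_proOmissive
  refine ⟨⟨p, U.map f.toMonoidHom, hp, isOpen_map_of_isOpen_of_surjective f hf U hUo, ?_⟩⟩
  -- the corestriction `U ↠ f(U)` is a continuous surjection
  let φ : U →ₜ* (U.map f.toMonoidHom : Subgroup H) :=
    ⟨f.toMonoidHom.subgroupMap U,
      Continuous.subtype_mk ((map_continuous f).comp continuous_subtype_val) _⟩
  exact hU.of_surjective φ (f.toMonoidHom.subgroupMap_surjective U)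

omit [IsTopologicalGroup G] in
/-- An open subgroup of an open subgroup is (the image of) an open subgroup of the ambient group,
and pro-`Σ` transports to that image. [cite: MochizukiAbsTopI2012, Def 1.1 (iii) p.10] -/
theorem IsProSet.map_subtype_of_isOpen {U : Subgroup G} (hU : IsOpen (U : Set G))
    {V : Subgroup U} (hVo : IsOpen (V : Set U)) {S : Set ℕ} (hV : IsProSet V S) :
    IsOpen ((V.map U.subtype : Subgroup G) : Set G) ∧
      IsProSet (V.map U.subtype : Subgroup G) S := by
  refine ⟨?_, ?_⟩
  · have h1 : ((V.map U.subtype : Subgroup G) : Set G) = Subtype.val '' (V : Set U) := by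
      rw [Subgroup.coe_map]
      rfl
    rw [h1]
    exact hU.isOpenMap_subtype_val _ hVo
  · let φ : V →ₜ* (V.map U.subtype : Subgroup G) :=
      ⟨U.subtype.subgroupMap V,
        Continuous.subtype_mk (continuous_subtype_val.comp continuous_subtype_val) _⟩
    exact hV.of_surjective φ (U.subtype.subgroupMap_surjective V)

end Transport

/-! ### Open subgroups of `G_k` are not almost pro-omissive (the "surjection `G ↠ Ẑ`" input) -/

section Local

/-- For `k` a finite extension of `ℚ_p`, EVERY open subgroup `U ⊆ G_k` has `δ¹_q(U) ≥ 1` for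
EVERY prime `q`: `U = G_{k′}` for a finite extension `k′/k`, and
`δ¹_q(G_{k′}) ∈ {1, [k′:ℚ_p]+1}` by the rank formula of [AbsTopI] Thm 2.6 (ii)
(`thm26_ii_delta_gal_holds`, landed).  This is the form in which the printed proof of Thm 2.6
(iv) uses "the existence of a surjection `G ↠ Ẑ` [Prop 1.5 (ii)]".
[cite: MochizukiAbsTopI2012, Thm 2.6 (iv) p.22] -/
theorem one_le_freeProlRank_of_isOpen_absoluteGaloisGroup (p : ℕ) [Fact p.Prime] (K : Type)
    [Field K] [Algebra ℚ_[p] K] [FiniteDimensional ℚ_[p] K]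
    (U : Subgroup (absoluteGaloisGroup K)) (hU : IsOpen (U : Set (absoluteGaloisGroup K)))
    (q : ℕ) [Fact q.Prime] :
    1 ≤ freeProlRank U q := by
  haveI : CharZero K := charZero_of_injective_algebraMap (algebraMap ℚ_[p] K).injective
  obtain ⟨L, hLfin, -, hLU⟩ := exists_intermediateField_of_isOpen_absoluteGaloisGroup K U hU
  haveI := hLfin
  haveI : FiniteDimensional ℚ_[p] L := Module.Finite.trans K L
  obtain ⟨e⟩ := nonempty_continuousMulEquiv_fixingSubgroup K L
  rw [hLU] at e
  rw [freeProlRank_eq_of_continuousMulEquiv e q]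
  by_cases hqp : q = p
  · subst hqp
    rw [(thm26_ii_delta_gal_holds q L).2]
    exact_mod_cast Nat.le_add_left 1 _
  · rw [(thm26_ii_delta_gal_holds p L).1 q hqp]

/-- For `k` a finite extension of `ℚ_p`, NO open subgroup of `G_k` is pro-`Σ` for a set `Σ`
omitting a prime. [cite: MochizukiAbsTopI2012, Thm 2.6 (iv) p.22] -/
theorem not_isProSet_of_isOpen_absoluteGaloisGroup (p : ℕ) [Fact p.Prime] (K : Type) [Field K]
    [Algebra ℚ_[p] K] [FiniteDimensional ℚ_[p] K] (U : Subgroup (absoluteGaloisGroup K))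
    (hU : IsOpen (U : Set (absoluteGaloisGroup K))) {S : Set ℕ} {q : ℕ} (hq : q.Prime)
    (hqS : q ∉ S) : ¬ IsProSet U S := by
  haveI : Fact q.Prime := ⟨hq⟩
  exact not_isProSet_of_one_le_freeProlRank q
    (one_le_freeProlRank_of_isOpen_absoluteGaloisGroup p K U hU q) hqS

/-- For `k` a finite extension of `ℚ_p`, NO open subgroup of `G_k` is almost pro-omissive (an open
subgroup of an open subgroup is open in `G_k`, and is not pro-`(≠ q)`).
[cite: MochizukiAbsTopI2012, Thm 2.6 (iv) p.22] -/
theorem not_isAlmostProOmissive_of_isOpen_absoluteGaloisGroup (p : ℕ) [Fact p.Prime] (K : Type)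
    [Field K] [Algebra ℚ_[p] K] [FiniteDimensional ℚ_[p] K]
    (U : Subgroup (absoluteGaloisGroup K)) (hU : IsOpen (U : Set (absoluteGaloisGroup K))) :
    ¬ IsAlmostProOmissive U := by
  rintro ⟨q, V, hq, hVo, hV⟩
  obtain ⟨hV'o, hV'⟩ := IsProSet.map_subtype_of_isOpen hU hVo hV
  exact not_isProSet_of_isOpen_absoluteGaloisGroup p K _ hV'o hq (by simp) hV'

end Local

/-! ### [AbsTopI] Thm 2.6 (iv) for abstract extensions with MLF base, given elasticity of `G` -/

namespace FundamentalExtension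

variable {E : FundamentalExtension.{0}}

/-- No open subgroup of `G` is almost pro-omissive, for ANY extension with MLF base data
`G ≅ G_k` (transport of `not_isAlmostProOmissive_of_isOpen_absoluteGaloisGroup` along the
isomorphism: an open subgroup of the profinite `G` is compact, and its image in `G_k` is open).
[cite: MochizukiAbsTopI2012, Thm 2.6 (iv) p.22] -/
theorem MLFBase.not_isAlmostProOmissive_of_isOpen (B : E.MLFBase) (M : Subgroup E.gal)
    (hM : IsOpen (M : Set E.gal)) : ¬ IsAlmostProOmissive M := by
  letI := B.instPrime
  intro h
  let f : E.gal →ₜ* absoluteGaloisGroup B.K :=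
    ⟨B.galIso.toMulEquiv.toMonoidHom, map_continuous B.galIso⟩
  have hMo' : IsOpen ((M.map f.toMonoidHom : Subgroup (absoluteGaloisGroup B.K)) :
      Set (absoluteGaloisGroup B.K)) := by
    have h1 : ((M.map f.toMonoidHom : Subgroup (absoluteGaloisGroup B.K)) :
        Set (absoluteGaloisGroup B.K)) = B.galIso '' (M : Set E.gal) := by
      rw [Subgroup.coe_map]
      rfl
    rw [h1]
    exact B.galIso.toHomeomorph.isOpenMap _ hM
  -- `M` is compact (closed in the profinite `G`), so almost pro-omissivity passes to `f(M)`
  haveI : CompactSpace M := isCompact_iff_compactSpace.mp (M.isClosed_of_isOpen hM).isCompact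
  let φ : M →ₜ* (M.map f.toMonoidHom : Subgroup (absoluteGaloisGroup B.K)) :=
    ⟨f.toMonoidHom.subgroupMap M,
      Continuous.subtype_mk ((map_continuous f).comp continuous_subtype_val) _⟩
  exact not_isAlmostProOmissive_of_isOpen_absoluteGaloisGroup B.p B.K _ hMo'
    (h.of_surjective φ (f.toMonoidHom.subgroupMap_surjective M))

/-- **[AbsTopI] Thm 2.6 (iv), first clause**, for ANY extension `1 → Δ → Π → G → 1` with MLF
base data, GIVEN the elasticity of `G` ([AbsTopI] Thm 1.7 (ii)): "every almost
pro-omissive topologically finitely generated closed normal subgroup of `Π` is contained in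
`Δ`".  Printed proof (p. 24): the image `M` of such an `N` in `G` is a topologically finitely
generated closed normal [almost pro-omissive] subgroup, so by elasticity `M` is trivial or of
finite index (hence open); the latter is excluded by the surjections `G′ ↠ Ẑ` of the open
subgroups `G′ ⊆ G`.
[cite: MochizukiAbsTopI2012, Thm 2.6 (iv) p.22] -/
theorem le_geom_of_isAlmostProOmissive_of_isElastic_gal (B : E.MLFBase) (hG : IsElastic E.gal)
    (N : Subgroup E.arith) (hN : N.Normal) (hNc : IsClosed (N : Set E.arith))
    (hNfg : IsTopologicallyFinitelyGenerated N) (hNapo : IsAlmostProOmissive N) : N ≤ E.geom := by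
  -- the image `M := aug(N) ⊆ G` and the continuous surjection `N ↠ M`
  set M : Subgroup E.gal := N.map E.aug.toMonoidHom with hMdef
  let φ : N →ₜ* M :=
    ⟨E.aug.toMonoidHom.subgroupMap N,
      Continuous.subtype_mk ((map_continuous E.aug).comp continuous_subtype_val) _⟩
  have hφ : Function.Surjective φ := E.aug.toMonoidHom.subgroupMap_surjective N
  have hMn : M.Normal := hN.map E.aug.toMonoidHom E.aug_surjective
  have hMc : IsClosed (M : Set E.gal) := by
    rw [hMdef, Subgroup.coe_map]
    exact (hNc.isCompact.image (map_continuous E.aug)).isClosed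
  have hMfg : IsTopologicallyFinitelyGenerated M := hNfg.of_surjective φ hφ
  haveI : CompactSpace N := isCompact_iff_compactSpace.mp hNc.isCompact
  have hMapo : IsAlmostProOmissive M := hNapo.of_surjective φ hφ
  -- elasticity of `G`, applied with the open subgroup `H = G` itself
  have htop : IsOpen (((⊤ : Subgroup E.gal)) : Set E.gal) := by
    rw [Subgroup.coe_top]
    exact isOpen_univ
  have hMn' : (M.subgroupOf ⊤).Normal := by
    refine (Subgroup.normal_subgroupOf_iff_le_normalizer le_top).mpr ?_
    rw [Subgroup.normalizer_eq_top M]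
  rcases hG.eq_bot_or_finiteIndex ⊤ M htop le_top hMn' hMc hMfg with hbot | hfin
  · -- `M = 1`: `N ⊆ Ker(aug) = Δ`
    intro x hx
    rw [mem_geom]
    have hxM : E.aug x ∈ M := ⟨x, hx, rfl⟩
    rw [hbot] at hxM
    exact Subgroup.mem_bot.mp hxM
  · -- `M` of finite index and closed, hence open: impossible
    haveI := hfin
    exact absurd hMapo (MLFBase.not_isAlmostProOmissive_of_isOpen B M
      (Subgroup.isOpen_of_isClosed_of_finiteIndex M hMc))

/-- **[AbsTopI] Thm 2.6 (iv)** (the typed predicate `E.Thm26iv Σ`) for ANY extension with MLF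
base data, GIVEN: the elasticity of `G` ([AbsTopI] Thm 1.7 (ii)), the topological finite
generation of `Δ` ([AbsTopI] Prop 2.2, BY NAME: `E.GeomTFG`), and the construction datum "`Δ` is
pro-`Σ`" with `Σ ⊆ Primes` (Def 2.1 (i): `Δ` is the maximal pro-`Σ` quotient).  Second clause:
if `Σ ≠ Primes` pick a prime `q ∉ Σ`; then `Δ` is pro-`(≠ q)`, i.e. almost pro-omissive, so
with the first clause `Δ` is the maximal such subgroup — the typed second clause records exactly
"`Δ` is almost pro-omissive and topologically finitely generated".
[cite: MochizukiAbsTopI2012, Thm 2.6 (iv) p.22] -/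
theorem thm26iv_of_isElastic_gal (B : E.MLFBase) (hG : IsElastic E.gal) (hΔ : E.GeomTFG)
    {S : Set ℕ} (hS : S ⊆ {q | q.Prime}) (hΔS : IsProSet E.geom S) : E.Thm26iv S := by
  refine ⟨fun N hN hNc hNfg hNapo =>
    le_geom_of_isAlmostProOmissive_of_isElastic_gal B hG N hN hNc hNfg hNapo,
    fun hne => ⟨?_, hΔ⟩⟩
  -- a prime `q ∉ Σ`
  obtain ⟨q, hq, hqS⟩ : ∃ q, q.Prime ∧ q ∉ S := by
    by_contra hall
    push Not at hall
    exact hne (Set.Subset.antisymm hS fun q hq => hall q hq)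
  -- `Δ` is pro-`(≠ q)`, witnessed on the open subgroup `Δ` of `Δ` itself
  have htop : IsOpen (((⊤ : Subgroup E.geom)) : Set E.geom) := by
    rw [Subgroup.coe_top]
    exact isOpen_univ
  refine ⟨⟨q, ⊤, hq, htop, ?_⟩⟩
  have h1 : IsProSet E.geom {r | r.Prime ∧ r ≠ q} :=
    hΔS.mono fun r hr => ⟨hS hr, fun h => hqS (h ▸ hr)⟩
  let ι : E.geom →ₜ* (⊤ : Subgroup E.geom) :=
    ⟨(Subgroup.topEquiv : (⊤ : Subgroup E.geom) ≃* E.geom).symm.toMonoidHom,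
      Continuous.subtype_mk continuous_id _⟩
  exact h1.of_surjective ι (Subgroup.topEquiv (G := E.geom)).symm.surjective

/-! ### Under the characterization (iv), `Δ ⊆ Π` is preserved by isomorphisms of `Π` -/

section Transport

variable {E F : FundamentalExtension.{u}}

/-- If `F` satisfies [AbsTopI] Thm 2.6 (iv) (typed `F.Thm26iv T`) and `Δ_E` is topologically
finitely generated and almost pro-omissive, then every isomorphism of topological groups
`φ : Π_E ⥲ Π_F` carries `Δ_E` INTO `Δ_F` (its image is an almost pro-omissive topologically
finitely generated closed normal subgroup of `Π_F`) — the "group-theoretic characterization"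
clause of (iv) in use ([AbsTopII] Rmk 3.3.2 pattern).
[cite: MochizukiAbsTopI2012, Thm 2.6 (iv) p.22] -/
theorem geom_map_le_of_thm26iv {T : Set ℕ} (hF : F.Thm26iv T)
    (hEfg : IsTopologicallyFinitelyGenerated E.geom) (hEapo : IsAlmostProOmissive E.geom)
    (φ : E.arith ≃ₜ* F.arith) : E.geom.map φ.toMulEquiv.toMonoidHom ≤ F.geom := by
  set N : Subgroup F.arith := E.geom.map φ.toMulEquiv.toMonoidHom with hNdef
  -- the corestriction `Δ_E ↠ φ(Δ_E)` is a continuous surjection from a compact group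
  let f : E.arith →ₜ* F.arith := ⟨φ.toMulEquiv.toMonoidHom, φ.continuous⟩
  let ψ : E.geom →ₜ* N :=
    ⟨f.toMonoidHom.subgroupMap E.geom,
      Continuous.subtype_mk ((map_continuous f).comp continuous_subtype_val) _⟩
  have hψ : Function.Surjective ψ := f.toMonoidHom.subgroupMap_surjective E.geom
  haveI : CompactSpace E.geom := isCompact_iff_compactSpace.mp E.isClosed_geom.isCompact
  have hNn : N.Normal := E.normal_geom.map φ.toMulEquiv.toMonoidHom φ.surjective
  have hNc : IsClosed (N : Set F.arith) := by
    have : (N : Set F.arith) = φ '' (E.geom : Set E.arith) := by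
      rw [hNdef, Subgroup.coe_map]
      rfl
    rw [this]
    exact φ.toHomeomorph.isClosedMap _ E.isClosed_geom
  exact hF.1 N hNn hNc (hEfg.of_surjective ψ hψ) (hEapo.of_surjective ψ hψ)

/-- **[AbsTopI] Thm 2.6 (iv) ⟹ `Δ ⊆ Π` is preserved by isomorphisms** (the form [AbsAnab] Lemma
1.3.8 / [AbsTopI] Thm 2.14 (i) "`φ` induces `Δ₁ ≅ Δ₂`" and [AbsTopII] Rmk 3.3.2 use), in the case
`Σ ≠ Primes` on both sides: if `E`, `F` satisfy the typed Thm 2.6 (iv) with `Σ_E, Σ_F ≠ Primes`,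
every `φ : Π_E ⥲ Π_F` satisfies `PreservesGeom φ`.
[cite: MochizukiAbsTopI2012, Thm 2.6 (iv) p.22] -/
theorem preservesGeom_of_thm26iv {S T : Set ℕ} (hE : E.Thm26iv S) (hS : S ≠ {q | q.Prime})
    (hF : F.Thm26iv T) (hT : T ≠ {q | q.Prime}) (φ : E.arith ≃ₜ* F.arith) :
    PreservesGeom φ := by
  refine le_antisymm (geom_map_le_of_thm26iv hF (hE.2 hS).2 (hE.2 hS).1 φ) ?_
  -- `Δ_F = φ(φ⁻¹(Δ_F)) ⊆ φ(Δ_E)`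
  have h1 : F.geom.map φ.symm.toMulEquiv.toMonoidHom ≤ E.geom :=
    geom_map_le_of_thm26iv hE (hF.2 hT).2 (hF.2 hT).1 φ.symm
  have h2 : (F.geom.map φ.symm.toMulEquiv.toMonoidHom).map φ.toMulEquiv.toMonoidHom = F.geom := by
    rw [Subgroup.map_map]
    have : φ.toMulEquiv.toMonoidHom.comp φ.symm.toMulEquiv.toMonoidHom = MonoidHom.id _ := by
      ext x
      exact φ.apply_symm_apply x
    rw [this, Subgroup.map_id]
  calc F.geom = (F.geom.map φ.symm.toMulEquiv.toMonoidHom).map φ.toMulEquiv.toMonoidHom := h2.symm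
    _ ≤ E.geom.map φ.toMulEquiv.toMonoidHom := Subgroup.map_mono h1

/-- COROLLARY for MLF bases: for extensions `E`, `F` with MLF base data, ELASTIC `G_E`, `G_F`
([AbsTopI] Thm 1.7 (ii)), topologically finitely generated pro-`Σ` geometric groups `Δ_E`, `Δ_F`
(Prop 2.2 BY NAME) with `Σ_E, Σ_F ⊊ Primes`, every isomorphism `φ : Π_E ⥲ Π_F` carries `Δ_E`
onto `Δ_F` — "`Δ ⊆ Π` may be characterized group-theoretically" in the case `Σ ≠ Primes`.
[cite: MochizukiAbsTopI2012, Thm 2.6 (iv) p.22] -/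
theorem MLFBase.preservesGeom_of_isElastic_gal {E F : FundamentalExtension.{0}} (BE : E.MLFBase)
    (BF : F.MLFBase) (hGE : IsElastic E.gal) (hGF : IsElastic F.gal) (hΔE : E.GeomTFG)
    (hΔF : F.GeomTFG) {S T : Set ℕ} (hS : S ⊆ {q | q.Prime}) (hS' : S ≠ {q | q.Prime})
    (hES : IsProSet E.geom S) (hT : T ⊆ {q | q.Prime}) (hT' : T ≠ {q | q.Prime})
    (hFT : IsProSet F.geom T) (φ : E.arith ≃ₜ* F.arith) : PreservesGeom φ :=
  preservesGeom_of_thm26iv (thm26iv_of_isElastic_gal BE hGE hΔE hS hES) hS'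
    (thm26iv_of_isElastic_gal BF hGF hΔF hT hFT) hT' φ

end Transport

end FundamentalExtension

end Literature.AnabelianGeometry.AbsoluteAnabelian

end
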